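import Summits.CriticalPhenomena.PercolationContinuityZ3.Theorems.FK.Transplant.KNFreeSlabInnerRoutes
import HarnessLib

/-!
# FRONTIER TRANSPLANT, binder 2 (TP_FK) — T4-SLAB (L4): inner routes WITH A GATE COLUMN (T5/T5′/T6/T7) and route IC-B
# (gate column, then one face box beyond the column's face)

Support file (`--supports stmt-CriticalPhenomena-4575`, helper) of the FRONTIER TRANSPLANT sub-cell (`fk-continuity/transplant/`,
seat `prim-bschramm-fkt-p1`); builds on p205010 (kernel theorem, internal audit signed; external expert review pending).
0 definitions · 0 named facts · 0 sorries · standard axioms. File 6/18 of the bytes-first package (R60 (3)(β)) of the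
UNFUNDED memo row `T4-SLAB [g122, R60]` (re-described R62 (E)); proposable only on a coordinator ruling.
Registered R63 (cell INBOX l.4709, 2026-08-23); registry row T4s; lead label T4s-06 (fkt-lead L22, l.4677).

HONEST FRAMING (page 1, cell rule). The transplant's theorem of record `ufsc0_of_freeBoundaryHypothesis_r3` (p248245) is
CONDITIONAL on FH AND on TP_FK = `KNFreeTargetHittable d q p`, both OPEN at the same `p` for `q > 1` near `p_c(q)` (⇔ GRC Conj.
(5.103) via K1; barrier note `Literature.Barriers.CriticalPhenomena.SamePFreeBoundaryCriteria`, FBN-01, cited first); the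
transplant is a typed reduction, not a proof of FK continuity. THIS FILE: inner routes WITH A GATE COLUMN — `inner_column_route` (from the exit through the interior of the level box
to a gate foot, up the gate column through the collar by `T + 1` explicit edges, to a lane target on or just beyond
the face) and `inner_column_faceBox_route` (IC-B: the same followed by plate steps in the face box beyond the column's
face). It proves nothing about either binder and says nothing at `p ↓ p_c(q)`; NOT `_r4`; `_r3` « 2 / 0 ☑ », n_open = 2,
BINDER-OWNERS, FO-19 NO-GO unchanged.

Declarations: `inner_column_route`, `inner_column_faceBox_route`.

References: G. Grimmett, *The Random-Cluster Model*, Springer 2006, Thm. (3.1) eq. (3.4), Thm. (3.7), Thm. (3.8), Thm. (3.21)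
eq. (3.22), Lemma (4.13), §5.7 [Grimmett2006]; G. Kozma, S. Nitzan, arXiv:2401.12397 (2024), §4 Lemma 10 Step IV (pp. 19–21) [KozmaNitzan2024].
-/

noncomputable section

namespace Summit.CriticalPhenomena.PercolationContinuityZ3.Theorems.FK

open MeasureTheory
open scoped ENNReal Classical
open Literature.Probability.Percolation Literature.Probability.LatticeModels SimpleGraph
open Literature.Probability.Percolation.GadgetSystem Literature.Probability.Percolation.KozmaNitzan Transplant
open Literature.Barriers.CriticalPhenomena

variable {d : ℕ}

/-! ### (P1) v5 — ROUTES WITH A GATE COLUMN (inner): T5/T5′/T6/T7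

After the exit edge and the interior slab box (as in route T4, now ending at the column FOOT `wf`, depth `T+1`
below the face `(f, τf)`, `f ≠ c`), the lane climbs the GATE COLUMN `wf[f ↦ yf - τf(T+1-j)]`, `j = 0, 1, …`:
depths `T, …, 2` are gate vertices (NOT in `S`, by the choice of `S`), depth `1` is the one further frozen vertex
`w` the region allows, depth `0` is the boundary layer, and from depth `-1` on the column is beyond the face.
Route IC-A stops on the column (the target lies in the collar, on the boundary layer, or just beyond); route IC-B
continues from the first vertex beyond the face through ONE face box to the target. -/

/-- **Route IC-A (inner, gate column, target on the column).** `p̃^{n_e + 1} · β^{d m} ≤ φ^free_R(z ↔ col(n_e) in R)`,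
`R = (U ∩ slab) ∖ (S ∖ {z, w})`, `w = col(T)` the depth-1 vertex of the column.
[cite: KozmaNitzan2024, §4 Lemma 10 Step IV (pp. 19–21); Grimmett2006, Thm. (3.1) eq. (3.4), Thm. (3.8), eq. (3.22), §5.7 eq. (5.102)] -/
theorem inner_column_route {q : ℝ} (hq : 1 ≤ q) (p : unitInterval) (hd : 3 ≤ d) {L : ℕ}
    {β : ℝ} (hβ0 : 0 ≤ β) (hβ1 : β ≤ 1)
    (hβ : ∀ (N : ℕ) (g : zdGraph d ≃g zdGraph d) (u z : Site d), u ∈ fkSlab d L N → z ∈ fkSlab d L N →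
      β ≤ (fkLaw ((fkSlab d L N).image g) (restrW (↑((fkSlab d L N).image g) : Set (Site d)) (lattW d p)) q).real
        (openConnIn (↑((fkSlab d L N).image g) : Set (Site d)) (g u) (g z)))
    (Lo Hi : Site d) (i : Fin d) (σ yi : ℤ) (hface : (σ = 1 ∧ yi = Hi i) ∨ (σ = -1 ∧ yi = Lo i))
    (T : ℕ) (v : Site d)
    (S : Finset (Site d)) (hS : S ⊆ Finset.Icc (Lo + 1) (Hi - 1))
    (hSint : ∀ x ∈ S, x ∉ Finset.Icc (Lo + ((T : Site d) + 1)) (Hi - ((T : Site d) + 1)))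
    (ℓ : ℕ) (g : Geom d) (c : Fin d) (hci : c ≠ i)
    (z : Site d) (ζ : ℤ) (hzi : z i = yi - σ * T) (hzc : z c = ζ)
    (hzQ : z ∈ g.Qset ℓ v)
    (N m : ℕ) (hLN : L ≤ N) (hm1 : 1 ≤ m)
    (hfat : ∀ b, b ≠ c → max (Lo b + T + 1) (v b + ℓ * g.loQ b) + 2 * (N : ℤ) ≤ min (Hi b - T - 1) (v b + ℓ * g.hiQ b))
    (hslabQ : v c + ℓ * g.loQ c ≤ ζ - L ∧ ζ + L ≤ v c + ℓ * g.hiQ c)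
    (hslabIn : Lo c + T + 1 ≤ ζ - L ∧ ζ + L ≤ Hi c - T - 1)
    (hx1 : ∀ b, b ≠ c → max (Lo b + T + 1) (v b + ℓ * g.loQ b) ≤ Function.update z i (yi - σ * ((T : ℤ) + 1)) b ∧
      Function.update z i (yi - σ * ((T : ℤ) + 1)) b ≤ min (Hi b - T - 1) (v b + ℓ * g.hiQ b))
    -- the column: face `(f, τf)`, foot `wf` (depth `T+1`), gate vertices at depths `2..T` outside `S`
    (f : Fin d) (hfc : f ≠ c) (τf yf : ℤ) (hfaceF : (τf = 1 ∧ yf = Hi f) ∨ (τf = -1 ∧ yf = Lo f))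
    (wf : Site d) (hwff : wf f = yf - τf * ((T : ℤ) + 1)) (hwfc : |wf c - ζ| ≤ (L : ℤ))
    (hwfI : ∀ b, b ≠ c → max (Lo b + T + 1) (v b + ℓ * g.loQ b) ≤ wf b ∧ wf b ≤ min (Hi b - T - 1) (v b + ℓ * g.hiQ b))
    (hdist : ∀ b, b ≠ c → |Function.update z i (yi - σ * ((T : ℤ) + 1)) b - wf b| ≤ (m : ℤ) * N)
    (hgate : ∀ j : ℕ, 1 ≤ j → j + 1 ≤ T → Function.update wf f (yf - τf * ((T : ℤ) + 1) + τf * j) ∉ S)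
    (ne : ℕ) (hQend : v f + ℓ * g.loQ f ≤ yf - τf * ((T : ℤ) + 1) + τf * ne ∧
      yf - τf * ((T : ℤ) + 1) + τf * ne ≤ v f + ℓ * g.hiQ f) :
    ((p : ℝ) / (p + q * (1 - p))) ^ (ne + 1) * β ^ (d * m) ≤
      (fkLaw (((g.Qset ℓ v).filter fun x => |x c - ζ| ≤ (L : ℤ)) \ (S \ {z, Function.update wf f (yf - τf)}))
        (restrW (↑(((g.Qset ℓ v).filter fun x => |x c - ζ| ≤ (L : ℤ)) \ (S \ {z, Function.update wf f (yf - τf)})) :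
          Set (Site d)) (lattW d p)) q).real
      (openConnIn (↑(((g.Qset ℓ v).filter fun x => |x c - ζ| ≤ (L : ℤ)) \ (S \ {z, Function.update wf f (yf - τf)})) :
          Set (Site d)) z (Function.update wf f (yf - τf * ((T : ℤ) + 1) + τf * ne))) := by
  have hq0 : 0 < q := one_pos.trans_le hq
  set w := Function.update wf f (yf - τf) with hw
  set R := ((g.Qset ℓ v).filter fun x => |x c - ζ| ≤ (L : ℤ)) \ (S \ {z, w}) with hR
  haveI : IsProbabilityMeasure (fkLaw R (restrW (↑R : Set (Site d)) (lattW d p)) q) :=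
    isProbabilityMeasure_fkLaw _ _ hq0
  have hτ1 : τf = 1 ∨ τf = -1 := hfaceF.elim (fun h => Or.inl h.1) (fun h => Or.inr h.1)
  -- the interior part: `z → x₁ → wf`
  have hin := inner_direct_route hq p hd hβ0 hβ1 hβ Lo Hi i σ yi hface T v S hSint ℓ g c hci z ζ hzi hzc hzQ N m hLN
    hm1 hfat hslabQ hslabIn hx1 wf w hwfc hwfI hdist
  -- the column points are in the region
  have hwfQ : v f + ℓ * g.loQ f ≤ yf - τf * ((T : ℤ) + 1) ∧ yf - τf * ((T : ℤ) + 1) ≤ v f + ℓ * g.hiQ f := by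
    rw [← hwff]; exact ⟨(le_max_right _ _).trans (hwfI f hfc).1, (hwfI f hfc).2.trans (min_le_right _ _)⟩
  have hwfIn : Lo f + T + 1 ≤ yf - τf * ((T : ℤ) + 1) ∧ yf - τf * ((T : ℤ) + 1) ≤ Hi f - T - 1 := by
    rw [← hwff]; exact ⟨(le_max_left _ _).trans (hwfI f hfc).1, (hwfI f hfc).2.trans (min_le_left _ _)⟩
  have hcolR : ∀ j : ℕ, j ≤ ne → Function.update wf f (yf - τf * ((T : ℤ) + 1) + τf * j) ∈ R := by
    intro j hj
    have hj0 : (0 : ℤ) ≤ j := Nat.cast_nonneg j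
    have hjne : (j : ℤ) ≤ ne := by exact_mod_cast hj
    refine mem_laneRegion (mem_Qset_of_forall fun b => ?_) ?_ ?_
    · by_cases hbf : b = f
      · rw [hbf, Function.update_self]
        rcases hτ1 with hτ | hτ
        · rw [hτ] at hwfQ hQend ⊢; constructor <;> linarith [hwfQ.1, hwfQ.2, hQend.1, hQend.2]
        · rw [hτ] at hwfQ hQend ⊢; constructor <;> linarith [hwfQ.1, hwfQ.2, hQend.1, hQend.2]
      · rw [Function.update_of_ne hbf]
        by_cases hbc : b = c
        · rw [hbc]; rw [abs_le] at hwfc; constructor <;> linarith [hslabQ.1, hslabQ.2, hwfc.1, hwfc.2]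
        · exact ⟨(le_max_right _ _).trans (hwfI b hbc).1, (hwfI b hbc).2.trans (min_le_right _ _)⟩
    · rw [Function.update_of_ne hfc.symm]; exact hwfc
    · -- frozen status by depth `T + 1 - j`
      rcases Nat.lt_or_ge j 1 with hj1 | hj1
      · -- `j = 0`: the foot, in the interior
        have hj' : j = 0 := by omega
        subst hj'
        refine Or.inl (not_mem_of_interior hSint fun b => ?_)
        by_cases hbf : b = f
        · rw [hbf, Function.update_self]; push_cast; rw [mul_zero, add_zero]; exact hwfIn
        · rw [Function.update_of_ne hbf]
          by_cases hbc : b = c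
          · rw [hbc]; rw [abs_le] at hwfc; constructor <;> linarith [hslabIn.1, hslabIn.2, hwfc.1, hwfc.2]
          · exact ⟨(le_max_left _ _).trans (hwfI b hbc).1, (hwfI b hbc).2.trans (min_le_left _ _)⟩
      · rcases Nat.lt_or_ge (j + 1) (T + 1) with hjT | hjT
        · -- gate vertex
          exact Or.inl (hgate j hj1 (by omega))
        · rcases Nat.lt_or_ge j (T + 1) with hjT' | hjT'
          · -- `j = T`: the depth-1 vertex `w`
            have hjT'' : j = T := by omega
            subst hjT''
            refine Or.inr (Or.inr ?_)
            rw [hw]; congr 1; ring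
          · -- at or beyond the face
            refine Or.inl (not_mem_of_face hS hfaceF ?_)
            rw [Function.update_self]
            have hjT2 : ((T : ℤ) + 1) ≤ j := by exact_mod_cast hjT'
            rcases hτ1 with hτ | hτ <;> rw [hτ] <;> nlinarith
  have hcol := pow_le_fkLaw_restrW_real_openConnIn_segment hq p R wf f (yf - τf * ((T : ℤ) + 1)) τf hτ1 ne hcolR
  have hstart : Function.update wf f (yf - τf * ((T : ℤ) + 1)) = wf := by rw [← hwff, Function.update_eq_self]
  rw [hstart] at hcol
  have hπ0 : 0 ≤ (p : ℝ) / (p + q * (1 - p)) := div_nonneg p.2.1 (by nlinarith [p.2.1, p.2.2, hq0])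
  have h := mul_le_fkLaw_real_openConnIn_trans R _ hq (↑R : Set (Site d)) z wf _
    (mul_nonneg hπ0 (pow_nonneg hβ0 _)) hin hcol
  calc ((p : ℝ) / (p + q * (1 - p))) ^ (ne + 1) * β ^ (d * m)
      = ((p : ℝ) / (p + q * (1 - p))) * β ^ (d * m) * ((p : ℝ) / (p + q * (1 - p))) ^ ne := by ring
    _ ≤ _ := h


/-! ### (P1) v5 — ROUTE IC-B (inner, gate column, then one face box beyond the column's face) -/

/-- **Route IC-B (inner, gate column, face box).** The column of route IC-A is climbed to the first vertex beyond
the face `(f, τf)` (`n_e = T + 2` edges), then ONE face box `[aF, bF]` beyond that face (fatness `N₂`, `m₂` steps)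
leads to the target `t`: `p̃^{T+3} · β^{d m} · β^{d m₂} ≤ φ^free_R(z ↔ t in R)`.
[cite: KozmaNitzan2024, §4 Lemma 10 Step IV (pp. 19–21); Grimmett2006, Thm. (3.1) eq. (3.4), Thm. (3.8), eq. (3.22), §5.7 eq. (5.102)] -/
theorem inner_column_faceBox_route {q : ℝ} (hq : 1 ≤ q) (p : unitInterval) (hd : 3 ≤ d) {L : ℕ}
    {β : ℝ} (hβ0 : 0 ≤ β) (hβ1 : β ≤ 1)
    (hβ : ∀ (N : ℕ) (g : zdGraph d ≃g zdGraph d) (u z : Site d), u ∈ fkSlab d L N → z ∈ fkSlab d L N →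
      β ≤ (fkLaw ((fkSlab d L N).image g) (restrW (↑((fkSlab d L N).image g) : Set (Site d)) (lattW d p)) q).real
        (openConnIn (↑((fkSlab d L N).image g) : Set (Site d)) (g u) (g z)))
    (Lo Hi : Site d) (i : Fin d) (σ yi : ℤ) (hface : (σ = 1 ∧ yi = Hi i) ∨ (σ = -1 ∧ yi = Lo i))
    (T : ℕ) (v : Site d)
    (S : Finset (Site d)) (hS : S ⊆ Finset.Icc (Lo + 1) (Hi - 1))
    (hSint : ∀ x ∈ S, x ∉ Finset.Icc (Lo + ((T : Site d) + 1)) (Hi - ((T : Site d) + 1)))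
    (ℓ : ℕ) (g : Geom d) (hloQ : ∀ b, g.loQ b ≤ -1) (hhiQ : ∀ b, 1 ≤ g.hiQ b) (c : Fin d) (hci : c ≠ i)
    (z : Site d) (ζ : ℤ) (hzi : z i = yi - σ * T) (hzc : z c = ζ)
    (hzQ : z ∈ g.Qset ℓ v)
    (N m : ℕ) (hLN : L ≤ N) (hm1 : 1 ≤ m)
    (hfat : ∀ b, b ≠ c → max (Lo b + T + 1) (v b + ℓ * g.loQ b) + 2 * (N : ℤ) ≤ min (Hi b - T - 1) (v b + ℓ * g.hiQ b))
    (hslabQ : v c + ℓ * g.loQ c ≤ ζ - L ∧ ζ + L ≤ v c + ℓ * g.hiQ c)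
    (hslabIn : Lo c + T + 1 ≤ ζ - L ∧ ζ + L ≤ Hi c - T - 1)
    (hx1 : ∀ b, b ≠ c → max (Lo b + T + 1) (v b + ℓ * g.loQ b) ≤ Function.update z i (yi - σ * ((T : ℤ) + 1)) b ∧
      Function.update z i (yi - σ * ((T : ℤ) + 1)) b ≤ min (Hi b - T - 1) (v b + ℓ * g.hiQ b))
    (f : Fin d) (hfc : f ≠ c) (τf yf : ℤ) (hfaceF : (τf = 1 ∧ yf = Hi f) ∨ (τf = -1 ∧ yf = Lo f))
    (wf : Site d) (hwff : wf f = yf - τf * ((T : ℤ) + 1)) (hwfc : |wf c - ζ| ≤ (L : ℤ))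
    (hwfI : ∀ b, b ≠ c → max (Lo b + T + 1) (v b + ℓ * g.loQ b) ≤ wf b ∧ wf b ≤ min (Hi b - T - 1) (v b + ℓ * g.hiQ b))
    (hdist : ∀ b, b ≠ c → |Function.update z i (yi - σ * ((T : ℤ) + 1)) b - wf b| ≤ (m : ℤ) * N)
    (hgate : ∀ j : ℕ, 1 ≤ j → j + 1 ≤ T → Function.update wf f (yf - τf * ((T : ℤ) + 1) + τf * j) ∉ S)
    -- the face box `[aF, bF]` beyond the face `(f, τf)`, its fatness `N₂`, and the target `t`
    (aF bF : ℤ) (haF : v f + ℓ * g.loQ f ≤ aF) (hbF : bF ≤ v f + ℓ * g.hiQ f)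
    (hout : ∀ w : ℤ, aF ≤ w → w ≤ bF → 0 ≤ τf * (w - yf)) (hxB : aF ≤ yf + τf ∧ yf + τf ≤ bF)
    (N₂ m₂ : ℕ) (hN₂ : aF + 2 * (N₂ : ℤ) ≤ bF) (hN₂ℓ : N₂ ≤ ℓ) (hLN₂ : L ≤ N₂)
    (t : Site d) (htc : ζ - L ≤ t c ∧ t c ≤ ζ + L) (htf : aF ≤ t f ∧ t f ≤ bF)
    (htb : ∀ b, b ≠ c → b ≠ f → v b + ℓ * g.loQ b ≤ t b ∧ t b ≤ v b + ℓ * g.hiQ b)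
    (hdist₂ : ∀ b, b ≠ c → b ≠ f → |wf b - t b| ≤ (m₂ : ℤ) * N₂) (hdist₂f : |yf + τf - t f| ≤ (m₂ : ℤ) * N₂)
    (hdist₂c : |wf c - t c| ≤ (m₂ : ℤ) * L) :
    ((p : ℝ) / (p + q * (1 - p))) ^ (T + 3) * β ^ (d * m) * β ^ (d * m₂) ≤
      (fkLaw (((g.Qset ℓ v).filter fun x => |x c - ζ| ≤ (L : ℤ)) \ (S \ {z, Function.update wf f (yf - τf)}))
        (restrW (↑(((g.Qset ℓ v).filter fun x => |x c - ζ| ≤ (L : ℤ)) \ (S \ {z, Function.update wf f (yf - τf)})) :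
          Set (Site d)) (lattW d p)) q).real
      (openConnIn (↑(((g.Qset ℓ v).filter fun x => |x c - ζ| ≤ (L : ℤ)) \ (S \ {z, Function.update wf f (yf - τf)})) :
          Set (Site d)) z t) := by
  have hq0 : 0 < q := one_pos.trans_le hq
  have hd2 : 2 ≤ d := by omega
  set w := Function.update wf f (yf - τf) with hw
  set R := ((g.Qset ℓ v).filter fun x => |x c - ζ| ≤ (L : ℤ)) \ (S \ {z, w}) with hR
  haveI : IsProbabilityMeasure (fkLaw R (restrW (↑R : Set (Site d)) (lattW d p)) q) :=
    isProbabilityMeasure_fkLaw _ _ hq0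
  have hτ1 : τf = 1 ∨ τf = -1 := hfaceF.elim (fun h => Or.inl h.1) (fun h => Or.inr h.1)
  -- exit edge, interior box, column up to the first vertex beyond the face
  have hend : yf - τf * ((T : ℤ) + 1) + τf * ((T + 2 : ℕ) : ℤ) = yf + τf := by push_cast; ring
  have hQend : v f + ℓ * g.loQ f ≤ yf - τf * ((T : ℤ) + 1) + τf * ((T + 2 : ℕ) : ℤ) ∧
      yf - τf * ((T : ℤ) + 1) + τf * ((T + 2 : ℕ) : ℤ) ≤ v f + ℓ * g.hiQ f := by
    rw [hend]; exact ⟨haF.trans hxB.1, hxB.2.trans hbF⟩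
  have hcol := inner_column_route hq p hd hβ0 hβ1 hβ Lo Hi i σ yi hface T v S hS hSint ℓ g c hci z ζ hzi hzc hzQ N m
    hLN hm1 hfat hslabQ hslabIn hx1 f hfc τf yf hfaceF wf hwff hwfc hwfI hdist hgate (T + 2) hQend
  rw [hend] at hcol
  -- the face box beyond `(f, τf)`
  set xB := Function.update wf f (yf + τf) with hxBdef
  have hBsub := faceBox_subset_laneRegion hS hfc hfaceF hslabQ haF hbF hout z w
  obtain ⟨hwideB, hfatB⟩ := faceBox_wide (v := v) (f := f) (c := c) (ζ := ζ) hloQ hhiQ hN₂ hN₂ℓ hLN₂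
  rw [abs_le] at hwfc
  have hxBmem := mem_faceBox (v := v) (f := f) (c := c) (g := g) (ℓ := ℓ) (ζ := ζ) (L := L) (aF := aF) (bF := bF)
    (x := xB) (by rw [hxBdef, Function.update_of_ne hfc.symm]; constructor <;> linarith [hwfc.1, hwfc.2])
    (by rw [hxBdef, Function.update_self]; exact hxB)
    (fun b hbc hbf => by
      rw [hxBdef, Function.update_of_ne hbf]
      exact ⟨(le_max_right _ _).trans (hwfI b hbc).1, (hwfI b hbc).2.trans (min_le_right _ _)⟩)
  have htmem := mem_faceBox (v := v) (f := f) (c := c) (g := g) (ℓ := ℓ) (ζ := ζ) (L := L) (aF := aF) (bF := bF)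
    (x := t) htc htf htb
  have hdc : |xB c - t c| ≤ (m₂ : ℤ) * L := by rw [hxBdef, Function.update_of_ne hfc.symm]; exact hdist₂c
  have hdistB : ∀ b, b ≠ c → |xB b - t b| ≤ (m₂ : ℤ) * N₂ := by
    intro b hbc
    by_cases hbf : b = f
    · rw [hbf, hxBdef, Function.update_self]; exact hdist₂f
    · rw [hxBdef, Function.update_of_ne hbf]; exact hdist₂ b hbc hbf
  obtain ⟨e, hef, hec⟩ := Fin.exists_ne_and_ne_of_two_lt f c hd
  have hbox : β ^ (d * m₂) ≤ (fkLaw R (restrW (↑R : Set (Site d)) (lattW d p)) q).real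
      (openConnIn (↑R : Set (Site d)) xB t) :=
    le_fkLaw_restrW_real_openConnIn_of_subbox hq p hBsub xB t
      (pow_le_fkLaw_Icc_real_openConnIn_slabBox hq p hd2 hβ0 hβ1 hβ _ _ c f e hef.symm hfc hec hwideB N₂ hfatB m₂
        hxBmem htmem hdc hdistB)
  have hπ0 : 0 ≤ (p : ℝ) / (p + q * (1 - p)) := div_nonneg p.2.1 (by nlinarith [p.2.1, p.2.2, hq0])
  exact mul_le_fkLaw_real_openConnIn_trans R _ hq (↑R : Set (Site d)) z xB t
    (mul_nonneg (pow_nonneg hπ0 _) (pow_nonneg hβ0 _)) hcol hbox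

end Summit.CriticalPhenomena.PercolationContinuityZ3.Theorems.FK

end
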